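import Summits.ABC.IUTFork.Joshi.ATS4LocusUpperBounds
import Summits.ABC.IUTFork.Joshi.ATS4SecondMainBound

/-!
# Joshi, *Arithmetic Teichmüller Spaces IV* (arXiv:2403.10430v2) §6.10–§6.11: the E4 → E5 junction COMPOSED in the kernel —
# E-t4's Thm 6.10.1 AS DISPLAYED (over [J-III]'s adelic locus data) ⟺ E-t31's Thm 6.10.1 with its §6.11 interior

Bridge file of the abc-iut cell, branch E «type Joshi's construction, test vs S» (rung LADDER-ABC:A2.E; seat abc-iut-E-t31, slot T-31,
merge-debt reconciliation per plan/E/ASSIGNMENTS.md §4 (3)). **No side is taken** on [IUTchIII] Cor. 3.12 / [IUTchIV] Thm 1.10, on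
Joshi's claims (unrefereed arXiv preprints) or on Mochizuki's report on them; typed ≠ proved ≠ endorsed. Nothing of the papers is
asserted: every printed assertion stays a hypothesis BY NAME. What is proved: the two independently typed carriers of Thm 6.10.1 —
E-t4's `SecondMainBoundDatum` (the display p.66 l.12–40 over [J-III]'s `AdelicLocusDatum` at `y₀` and `φ(y₀)`, with `C_Θ` a free real and
the upper bound an opaque clause «its interior is the §6 seat's», `Joshi/ATS4SecondMainBound.lean` p-id of record in plan/E) and E-t31's
`LocusVolumeDatum` (§6.8–§6.11 with the printed `C_Θ` and the PROVED assembly (6.11.2) ⟹ (6.11.6) ⟹ upper bound,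
`Joshi/ATS4LocusUpperBounds.lean` p430311) — agree under the evident identifications (`DescentGlue`, OUR READING of «the same quantity
printed in two places»):

1. `thm6101_iff_secondMainBound`: `LocusVolumeDatum.Thm6101` ⟺ `SecondMainBoundDatum.SecondMainBound`.
2. `lowerBound_of_cor91111`: E-t31's `LowerBound` clause IS [J-III] Cor 9.11.1.1 as typed by E-t4 (p428048) at the shifted
   arithmeticoid, given the q-side shift equality (p.66 l.41–43, p.67 l.37–40).
3. `secondMainBound_of_inputs`: END TO END at the junction — [J-III]'s three inputs at `φ(y₀)` ((9.9.4) valuation scaling, Lemma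
   9.10.7.1 at the exhibited element, «LogVol ≤ 0») + the printed inputs of [J-IV] §6.8/§6.11 ((6.11.1), Prop 6.10.9 on `V^dst_ℚ`, the
   component sums, Lemma 6.4.2 (2), (6.8.11), Lemma 6.7.8, the two Frobenius-shift equalities, «(1/2ℓ) log q = |log q_ℓ|») + the glue
   ⟹ E-t4's `SecondMainBound` ∧ `C_Θ ≥ −1` — i.e. the opaque clause `SecondMainBoundDatum.UpperBound` is DISCHARGED MODULO the named
   §6 inputs. The further descent `C_Θ ≥ −1 ⟹ Thm 6.1.1` through E-t30's `MainBoundDatum.toThm110` and the tree's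
   `Thm110Numerics.display_of_neg_one_le_CTheta` (`ℓ ≥ 7`) is the sibling file `Joshi/ATS4DescentToFirstMainBound.lean`.

Shape (E-PLAN R2/R9): volume-shaped, S-bypassed; no TEST line. Object/bridge file (R14): imports Joshi object files only.
[claim: Joshi2024ATS4, status: disputed]; [claim: Joshi2024ATS3, status: disputed].
-/

noncomputable section

namespace Summit.ABC.IUTFork.Joshi.ATS4

variable {lstar : ℕ} {W : Type} [Fintype W]

/-- **The identifications between the two typed carriers of Thm 6.10.1** (OUR READING; each field names one printed quantity the two
files carry separately): `ℓ = 2ℓ* + 1` ([J-III] §3); `|log(q_ℓ)|` and `|log Vol(hull(Θ̃^𝓘))|` at `y₀` and at `φ(y₀)` read as E-t4's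
sums over the places `w ∈ V^{odd,ss}` ((6.11.7) p.71 l.89–100; (6.11.1) p.69 l.73 – p.70 l.3 and [J-III] p.128 l.2–8 «−|LogVol(Θ̃^𝓘)| =
Σ_p −|LogVol(Θ̃_p)|», the per-`p` ↔ per-`w` bundling [J-III] (9.10.4.1)); E-t4's free constant `C_Θ` = the printed formula
(`LocusVolumeDatum.CTheta`). Never asserted; a hypothesis of every theorem below. [claim: Joshi2024ATS4, status: disputed] -/
structure DescentGlue (D : SecondMainBoundDatum lstar W) (d : LocusVolumeDatum) : Prop where
  /-- `ℓ = 2ℓ* + 1` -/ l_eq_lstar : (d.l : ℝ) = 2 * lstar + 1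
  /-- `|log(q^{y₀}_ℓ)| = Σ_w |log|q_w^{1/2ℓ}||` at `y₀` -/ absLogQ_eq : d.absLogThetaQ = D.std.absLogQl
  /-- the same at `φ(y₀)` -/ absLogQFrob_eq : |d.absLogThetaQFrob| = D.shift.absLogQl
  /-- `|log Vol(hull(Θ̃^{𝓘,y₀}))| = Σ_w |log Vol(Θ̃_w)|` -/ absLogVol_eq : |d.logVolHull| = D.std.absLogVol
  /-- the same at `φ(y₀)` -/ absLogVolFrob_eq : |d.logVolHullFrob| = D.shift.absLogVol
  /-- E-t4's constant `C_Θ` is the printed formula -/ cTheta_eq : D.CTheta = d.CTheta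

namespace DescentGlue

variable {D : SecondMainBoundDatum lstar W} {d : LocusVolumeDatum} (G : DescentGlue D d)
include G

/-- Under the glue, `ℓ* = (ℓ − 1)/2` is E-t4's index `ℓ*`. [folklore] -/
theorem lstar_eq : d.lstar = (lstar : ℝ) := by
  unfold LocusVolumeDatum.lstar; rw [G.l_eq_lstar]; ring

/-- **Thm 6.10.1: the two typings of the display coincide** (E-t31's `Thm6101` ⟺ E-t4's `SecondMainBound`). PROVED under the glue.
[claim: Joshi2024ATS4, status: disputed] -/
theorem thm6101_iff_secondMainBound : d.Thm6101 ↔ D.SecondMainBound := by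
  have hA := d.absLogThetaQ_pos
  unfold LocusVolumeDatum.Thm6101 LocusVolumeDatum.FrobShiftQ LocusVolumeDatum.LowerBound LocusVolumeDatum.FrobShiftVol
    LocusVolumeDatum.UpperBound SecondMainBoundDatum.SecondMainBound SecondMainBoundDatum.FrobShiftEq
    SecondMainBoundDatum.HullVolShiftEq SecondMainBoundDatum.UpperBound
  rw [abs_of_pos hA, G.lstar_eq, G.absLogQ_eq, G.absLogQFrob_eq, G.absLogVol_eq, G.absLogVolFrob_eq, G.cTheta_eq]

/-- **E-t31's `LowerBound` from [J-III] Cor 9.11.1.1 at `φ(y₀)` (E-t4, p428048) and the q-side shift equality** (p.66 l.41–43, p.67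
l.37–40). [claim: Joshi2024ATS4, status: disputed] -/
theorem lowerBound_of_cor91111 (hc : D.shift.Cor91111) (hq : d.FrobShiftQ) : d.LowerBound := by
  rw [ATS3.AdelicLocusDatum.cor91111_iff_abs] at hc
  unfold LocusVolumeDatum.FrobShiftQ at hq
  unfold LocusVolumeDatum.LowerBound
  rw [G.lstar_eq, G.absLogVolFrob_eq, ← hq, G.absLogQFrob_eq]
  exact hc

/-- **END TO END at the E4 → E5 junction** ([J-III]'s three inputs at `φ(y₀)` + the printed inputs of [J-IV] §6.8/§6.11 + the glue ⟹
E-t4's `SecondMainBound` and `C_Θ ≥ −1`): E-t4's opaque clause `UpperBound` is discharged MODULO the named §6 inputs. PROVED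
(composition only; nothing of the papers is asserted). [claim: Joshi2024ATS4, status: disputed] -/
theorem secondMainBound_of_inputs (s₁ : D.shift.ValuationScaling) (s₂ : D.shift.HullVolumeLowerBound)
    (s₃ : D.shift.LogVolNonpos) (h₁ : d.Eq6111) (h₂ : ∀ p ∈ d.Vdst, d.Prop6109 p) (h₃ : d.ComponentSums) (h₄ : d.Lem642₂)
    (h₅ : d.Eq6811) (h₆ : d.Lem678) (h₈ : d.FrobShiftQ) (h₉ : d.FrobShiftVol) (hD : d.LogqDictionary) :
    D.SecondMainBound ∧ D.CThetaGeNegOne := by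
  have h₇ : d.LowerBound := G.lowerBound_of_cor91111 (D.shift.cor91111_of_inputs s₁ s₂ s₃) h₈
  have h := d.thm6101_of_inputs h₁ h₂ h₃ h₄ h₅ h₆ h₇ h₈ h₉ hD
  refine ⟨G.thm6101_iff_secondMainBound.1 h, ?_⟩
  unfold SecondMainBoundDatum.CThetaGeNegOne; rw [G.cTheta_eq]; exact d.neg_one_le_cTheta h

end DescentGlue

end Summit.ABC.IUTFork.Joshi.ATS4

end
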